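import Summits.Ventures.HodgeRepro.CMRank

/-!
# Integer rank certificates for `cmRank`

Seat `p1`, blind cell `pub-hodge-repro`.  Everything computational is done over `ℤ` so that the kernel
(`decide`) can check it: the type matrix is the `Int.cast`-image of the `0/1` integer matrix
`typeMatrixZ Φ`; a rank upper bound is an integer factorisation `L = P * Q` with `P` having `r` columns;
a rank lower bound is an `r × r` minor `B` of `L` with an integer matrix `C` and a nonzero integer `d`
such that `B * C = d • 1` (`C` = adjugate, `d` = determinant).
-/

open Finset
open scoped Pointwise

namespace HodgeRepro

section Generic

variable {m n : Type*} [Fintype n]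

/-- Integer factorisation `A = P * Q` with `P : m × Fin r` bounds the rational rank by `r`. -/
theorem rank_le_of_factor {r : ℕ} (A : Matrix m n ℤ) (P : Matrix m (Fin r) ℤ) (Q : Matrix (Fin r) n ℤ)
    (h : A = P * Q) : (A.map (Int.castRingHom ℚ)).rank ≤ r := by
  rw [h, Matrix.map_mul]
  exact (Matrix.rank_mul_le_left _ _).trans
    ((Matrix.rank_le_card_width _).trans_eq (Fintype.card_fin r))

/-- An integer `r × r` minor with nonzero determinant bounds the rational rank from below by `r`. -/
theorem le_rank_of_minor {r : ℕ} (A : Matrix m n ℤ) (rows : Fin r → m) (cols : Fin r → n)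
    (h : (A.submatrix rows cols).det ≠ 0) : r ≤ (A.map (Int.castRingHom ℚ)).rank := by
  have hdet : ((A.map (Int.castRingHom ℚ)).submatrix rows cols).det ≠ 0 := by
    rw [Matrix.submatrix_map, Int.coe_castRingHom, ← Int.cast_det]
    exact_mod_cast h
  have h1 : ((A.map (Int.castRingHom ℚ)).submatrix rows cols).rank = r := by
    rw [Matrix.rank_of_isUnit _ ((Matrix.isUnit_iff_isUnit_det _).2 (isUnit_iff_ne_zero.2 hdet)),
      Fintype.card_fin]
  rw [← h1]
  exact Matrix.rank_submatrix_le _ _ _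

/-- Kernel-checkable form of the lower bound: a minor `B` with `B * C = d • 1`, `d ≠ 0`
(`C` = adjugate of `B`, `d = det B`). -/
theorem le_rank_of_adj {r : ℕ} (A : Matrix m n ℤ) (rows : Fin r → m) (cols : Fin r → n)
    (C : Matrix (Fin r) (Fin r) ℤ) (d : ℤ) (hd : d ≠ 0)
    (h : A.submatrix rows cols * C = d • (1 : Matrix (Fin r) (Fin r) ℤ)) :
    r ≤ (A.map (Int.castRingHom ℚ)).rank := by
  refine le_rank_of_minor A rows cols fun h0 => ?_
  have hdet := congrArg Matrix.det h
  rw [Matrix.det_mul, h0, zero_mul, Matrix.det_smul, Matrix.det_one, mul_one, Fintype.card_fin] at hdet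
  exact pow_ne_zero r hd hdet.symm

end Generic

variable {G : Type*} [Group G] [Fintype G] [DecidableEq G]

/-- The integer type matrix `(g, h) ↦ [h ∈ gΦ]`. -/
def typeMatrixZ (Φ : Finset G) : Matrix G G ℤ := fun g h => if h ∈ g • Φ then 1 else 0

omit [Fintype G] in
/-- The rational type matrix is the cast of the integer one. -/
theorem typeMatrix_eq_map (Φ : Finset G) :
    typeMatrix Φ = (typeMatrixZ Φ).map (Int.castRingHom ℚ) := by
  ext g h
  simp only [typeMatrix_apply, typeMatrixZ, Matrix.map_apply]
  split_ifs <;> simp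

/-- The rank of a CM type from an integer certificate: an enumeration `f : Fin n ≃ G`, the literal
`L` of the reindexed type matrix, a factorisation `L = P * Q` through `ℤ^r`, and an `r × r` minor with
an adjugate certificate. -/
theorem cmRank_eq_of_cert {n r : ℕ} (Φ : Finset G) (f : Fin n ≃ G) (L : Matrix (Fin n) (Fin n) ℤ)
    (hL : (typeMatrixZ Φ).submatrix f f = L)
    (P : Matrix (Fin n) (Fin r) ℤ) (Q : Matrix (Fin r) (Fin n) ℤ) (hPQ : L = P * Q)
    (rows cols : Fin r → Fin n) (C : Matrix (Fin r) (Fin r) ℤ) (d : ℤ) (hd : d ≠ 0)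
    (hC : L.submatrix rows cols * C = d • (1 : Matrix (Fin r) (Fin r) ℤ)) : cmRank Φ = r := by
  have key : cmRank Φ = (L.map (Int.castRingHom ℚ)).rank := by
    unfold cmRank
    rw [typeMatrix_eq_map, ← hL, ← Matrix.submatrix_map, Matrix.rank_submatrix]
  rw [key]
  exact le_antisymm (rank_le_of_factor L P Q hPQ) (le_rank_of_adj L rows cols C d hd hC)

/-- Upper-bound-only variant (for nondegenerate types the upper bound `cmRank_le_half_add_one` is
generic, only the minor is needed). -/
theorem le_cmRank_of_cert {n r : ℕ} (Φ : Finset G) (f : Fin n ≃ G) (L : Matrix (Fin n) (Fin n) ℤ)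
    (hL : (typeMatrixZ Φ).submatrix f f = L)
    (rows cols : Fin r → Fin n) (C : Matrix (Fin r) (Fin r) ℤ) (d : ℤ) (hd : d ≠ 0)
    (hC : L.submatrix rows cols * C = d • (1 : Matrix (Fin r) (Fin r) ℤ)) : r ≤ cmRank Φ := by
  have key : cmRank Φ = (L.map (Int.castRingHom ℚ)).rank := by
    unfold cmRank
    rw [typeMatrix_eq_map, ← hL, ← Matrix.submatrix_map, Matrix.rank_submatrix]
  rw [key]
  exact le_rank_of_adj L rows cols C d hd hC

/-- An enumeration of a finite group from a duplicate-free complete list. -/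
def enumOfList (l : List G) (nd : l.Nodup) (h : ∀ x, x ∈ l) : Fin l.length ≃ G :=
  List.Nodup.getEquivOfForallMemList l nd h

/-- Translation invariance in the form used with the orbit covering lemmas. -/
theorem cmRank_eq_of_orbit {Φ R : Finset G} {r : ℕ} (hR : cmRank R = r) (g : G)
    (hΦ : Φ = g • R) : cmRank Φ = r := by
  rw [hΦ, cmRank_smul, hR]

/-- Compact certificate: the factorisation is built from the minor itself.  With `B = L[I, J]`,
`C = adj B`, `d = det B` one has `d • L = (L[:, J] * C) * L[I, :]` when `rank L = r`. -/
theorem cmRank_eq_of_cert' {n r : ℕ} (Φ : Finset G) (f : Fin n ≃ G) (L : Matrix (Fin n) (Fin n) ℤ)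
    (hL : (typeMatrixZ Φ).submatrix f f = L)
    (rows cols : Fin r → Fin n) (C : Matrix (Fin r) (Fin r) ℤ) (d : ℤ) (hd : d ≠ 0)
    (hC : L.submatrix rows cols * C = d • (1 : Matrix (Fin r) (Fin r) ℤ))
    (hPQ : d • L = (L.submatrix id cols * C) * L.submatrix rows id) : cmRank Φ = r := by
  have key : cmRank Φ = (L.map (Int.castRingHom ℚ)).rank := by
    unfold cmRank
    rw [typeMatrix_eq_map, ← hL, ← Matrix.submatrix_map, Matrix.rank_submatrix]
  rw [key]
  refine le_antisymm ?_ (le_rank_of_adj L rows cols C d hd hC)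
  -- upper bound: `L.map cast = (d⁻¹ • P.map cast) * Q.map cast`
  have hd' : (d : ℚ) ≠ 0 := by exact_mod_cast hd
  have hmap : (d • L).map (Int.castRingHom ℚ) = (d : ℚ) • L.map (Int.castRingHom ℚ) := by
    ext i j
    simp only [Matrix.map_apply, Matrix.smul_apply, smul_eq_mul, Int.coe_castRingHom, Int.cast_mul]
  have h2 : L.map (Int.castRingHom ℚ) =
      ((d : ℚ)⁻¹ • ((L.submatrix id cols * C).map (Int.castRingHom ℚ))) *
        (L.submatrix rows id).map (Int.castRingHom ℚ) := by
    rw [Matrix.smul_mul, ← Matrix.map_mul, ← hPQ, hmap, smul_smul, inv_mul_cancel₀ hd', one_smul]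
  rw [h2]
  exact (Matrix.rank_mul_le_right _ _).trans
    ((Matrix.rank_le_card_height _).trans_eq (Fintype.card_fin r))

/-! ### Enumerating CM types by choice vectors -/

/-- The CM type determined by a system of representatives `reps` of the conjugate pairs `{x, c x}`
and a choice vector `b` (`b i = true` picks `reps i`, `false` picks `c * reps i`). -/
def ofChoice (c : G) {k : ℕ} (reps : Fin k → G) (b : Fin k → Bool) : Finset G :=
  Finset.univ.image fun i => if b i then reps i else c * reps i

omit [Fintype G] in
/-- Every CM type is `ofChoice c reps b` for some choice vector `b`, provided `reps` meets every
conjugate pair. -/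
theorem exists_ofChoice {c : G} {k : ℕ} (reps : Fin k → G)
    (hreps : ∀ x : G, ∃ i, x = reps i ∨ x = c * reps i) {Φ : Finset G} (hΦ : IsCMType c Φ) :
    ∃ b : Fin k → Bool, Φ = ofChoice c reps b := by
  refine ⟨fun i => decide (reps i ∈ Φ), ?_⟩
  ext x
  simp only [ofChoice, Finset.mem_image, Finset.mem_univ, true_and]
  constructor
  · intro hx
    obtain ⟨i, hi⟩ := hreps x
    refine ⟨i, ?_⟩
    rcases hi with rfl | rfl
    · simp [hx]
    · have h : reps i ∉ Φ := fun h => (hΦ (reps i)).1 h hx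
      simp [h]
  · rintro ⟨i, hi⟩
    by_cases h : reps i ∈ Φ
    · simp only [h, decide_true, if_true] at hi
      exact hi ▸ h
    · simp only [h, decide_false] at hi
      subst hi
      by_contra hc
      exact h ((hΦ (reps i)).2 hc)

end HodgeRepro

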